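import Summits.CriticalPhenomena.Ising3DConformalLimit.Theses.LeeYangGap
import Summits.CriticalPhenomena.Ising3DConformalLimit.Theorems.PerfectScreeningCoulombImpliesNontrivialBlockLaw
import Literature.Analysis.Complex.Hurwitz
import Literature.Probability.LatticeModels.GibbsStatesProofs
import HarnessLib

/-!
# `LeeYangGap.MonotonicityTransfer` (item stmt-CriticalPhenomena-4948), proved

THEOREM-ONLY file (no definitions, no named facts). The glue item `MonotonicityTransfer` (support #9)
of route `LeeYangGap` (Ising3DConformalLimit): the finite-volume antitonicity of the first real zero
of `θ ↦ ⟨cos(θ M_L)⟩^free_{Λ_M;β,0}` in `β` (Camia–Jiang–Newman 2023, Thm 2; the route's item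
`FirstZeroAntitoneInBeta`, taken here as the hypothesis `H`) passes to the infinite-volume state
`⟨·⟩_β = plusExpect 3 β 0` for `0 ≤ β ≤ β' ≤ β_c(3)` and the block spin `M_L = Σ_{x ∈ box 3 L} σ_x`.

## Proof

Write `q_N(k) = ⟨1{M_L = k}⟩^free_{box 3 N;β,0}` and `p(k) = ⟨1{M_L = k}⟩⁺_{β,0}` (lattice laws on
`[-K, K]`, `K = |box 3 L|`), and likewise `q'_N`, `p'` at `β'`. Since `m*(β) = 0` for `β ≤ β_c(3)`
(`spontaneousMagnetization_eq_zero_of_lt_criticalBeta_holds`, `spontaneousMagnetization_criticalBeta_eq_zero_holds`),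
the free boxes converge to the plus state on local observables (`tendsto_isingExpect_free_spinFun`),
so `q_N → p`, `q'_N → p'` pointwise; `⟨f(M_L)⟩ = Σ_k (law)_k f(k)` in finite and infinite volume
(`apply_blockSpin_eq_sum`, `plusExpect_blockFun_eq_sum`); `p` is symmetric (`plusExpect_blockInd_neg`)
and `Σ_k q_N(k) e^{zk}` is zero-free off the imaginary axis (Lee–Yang, `sum_isingExpect_blockInd_mul_cexp_ne_zero`).
Suppose `⟨cos(θ₀ M_L)⟩_β = 0`, `θ₀ > 0`, but `⟨cos(θ' M_L)⟩_{β'} ≠ 0` for all `θ' ∈ (0, θ₀]`. The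
continuous function `g(s) = Σ_k p'(k) cos(sk) = ⟨cos(s M_L)⟩_{β'}` has `g(0) = 1` and no zero on
`[0, θ₀]`, hence (IVT, compactness, continuity at `θ₀`) `g ≥ c > 0` on `[0, θ₀ + η]` for some
`0 < η < θ₀`, and by the uniform convergence `sup_s |Σ_k (q'_N(k) - p'(k)) cos(sk)| ≤ Σ_k |q'_N(k) - p'(k)| → 0`
the finite-volume functions `⟨cos(s M_L)⟩^free_{box 3 N;β'}` are `> 0` on `[0, θ₀ + η]` for `N` large.
On the other hand `z ↦ Σ_k p(k) e^{zk}` is entire, equals `1` at `0`, and vanishes at `iθ₀` (its value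
there is the real number `Σ_k p(k) cos(θ₀ k) = ⟨cos(θ₀ M_L)⟩_β` by symmetry), so by Hurwitz's one-disc
theorem (`Complex.eventually_exists_zero_mem_ball_of_tendstoUniformlyOn`) the transforms
`Σ_k q_N(k) e^{zk}` have, for `N` large, a zero within `η` of `iθ₀` — purely imaginary by Lee–Yang,
`= it_N` with `|t_N - θ₀| < η`, i.e. `⟨cos(t_N M_L)⟩^free_{box 3 N;β} = 0` with `t_N > 0`. By `H` there
is a zero `θ' ∈ (0, t_N] ⊆ (0, θ₀ + η)` of `⟨cos(θ' M_L)⟩^free_{box 3 N;β'}` — contradiction.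

References: Camia–Jiang–Newman, CMP 401 (2023) 2459, Thm 2; Jiang–Newman, CPAM 77 (2024) 1224;
Friedli–Velenik, *Statistical Mechanics of Lattice Systems* (2017), Thm 3.17; Conway, GTM 11, VII.2.5.
-/

noncomputable section

namespace Summit.CriticalPhenomena.Ising3DConformalLimit.Theorems

open Literature.Probability.LatticeModels Filter Set Finset MeasureTheory Complex
open scoped Topology BigOperators
open Summit.CriticalPhenomena.Ising3DConformalLimit.Theses
open Summit.CriticalPhenomena.Ising3DConformalLimit.PerfectScreeningCoulombImpliesNontrivial

namespace LeeYangGapMonotonicityTransfer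

variable {d : ℕ}

/-! ### Block-spin functions in finite volume -/

/-- **Linearity in finite volume**: `⟨f(M_B)⟩^{bc}_{Λ;β,0} = Σ_{|k| ≤ |B|} ⟨1{M_B = k}⟩^{bc}_{Λ;β,0} f(k)`
for every `f : ℝ → ℝ` (the block spin `M_B = Σ_{x ∈ B} σ_x` is an integer in `[-|B|, |B|]`,
`apply_blockSpin_eq_sum`, and `⟨·⟩_Λ` is linear on measurable observables). -/
theorem isingExpect_blockFun_eq_sum (Λ B : Finset (Site d)) (β : ℝ)
    (bc : BoundaryCondition (Site d)) (f : ℝ → ℝ) :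
    isingExpect (zdGraph d) Λ β 0 bc (fun σ => f (∑ x ∈ B, spinAt x σ)) =
      ∑ k ∈ Finset.Icc (-(#B : ℤ)) (#B),
        isingExpect (zdGraph d) Λ β 0 bc
          (fun σ => if (∑ x ∈ B, spinAt x σ) = (k : ℝ) then (1 : ℝ) else 0) * f k := by
  have h1 : (fun σ : SpinConfig (Site d) => f (∑ x ∈ B, spinAt x σ)) = fun σ =>
      ∑ k ∈ Finset.Icc (-(#B : ℤ)) (#B),
        f k * (if (∑ x ∈ B, spinAt x σ) = (k : ℝ) then (1 : ℝ) else 0) := by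
    funext σ
    rw [apply_blockSpin_eq_sum B σ f]
    exact Finset.sum_congr rfl fun k _ => by rw [smul_eq_mul, mul_comm]
  rw [h1, isingExpect_finset_sum' _ _ _ _ β (Finset.Icc (-(#B : ℤ)) (#B))
    (fun (k : ℤ) (σ : SpinConfig (Site d)) =>
      f k * (if (∑ x ∈ B, spinAt x σ) = (k : ℝ) then (1 : ℝ) else 0))
    fun k => (measurable_blockInd B _).const_mul (f k)]
  refine Finset.sum_congr rfl fun k _ => ?_
  rw [isingExpect_const_mul' _ _ _ _ β (f k) (measurable_blockInd B _), mul_comm]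

/-! ### Lattice Laplace transforms at imaginary points -/

/-- The real part of `Σ_k q_k e^{itk}` is `Σ_k q_k cos(tk)` (real `q`, `t`). -/
theorem re_sum_mul_cexp_mul_I (S : Finset ℤ) (q : ℤ → ℝ) (t : ℝ) :
    (∑ k ∈ S, (q k : ℂ) * Complex.exp (((t : ℂ) * I) * (k : ℂ))).re =
      ∑ k ∈ S, q k * Real.cos (t * k) := by
  rw [Complex.re_sum]
  refine Finset.sum_congr rfl fun k _ => ?_
  have hk : ((t : ℂ) * I) * (k : ℂ) = ((t * k : ℝ) : ℂ) * I := by push_cast; ring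
  rw [hk, Complex.re_ofReal_mul, Complex.exp_ofReal_mul_I_re]

/-- The imaginary part of `Σ_k q_k e^{itk}` is `Σ_k q_k sin(tk)` (real `q`, `t`). -/
theorem im_sum_mul_cexp_mul_I (S : Finset ℤ) (q : ℤ → ℝ) (t : ℝ) :
    (∑ k ∈ S, (q k : ℂ) * Complex.exp (((t : ℂ) * I) * (k : ℂ))).im =
      ∑ k ∈ S, q k * Real.sin (t * k) := by
  rw [Complex.im_sum]
  refine Finset.sum_congr rfl fun k _ => ?_
  have hk : ((t : ℂ) * I) * (k : ℂ) = ((t * k : ℝ) : ℂ) * I := by push_cast; ring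
  rw [hk, Complex.im_ofReal_mul, Complex.exp_ofReal_mul_I_im]

/-- **Symmetric lattice laws have real transforms on the imaginary axis**: if `p(-k) = p(k)` on
`[-K, K]` then `Σ_k p_k e^{itk} = Σ_k p_k cos(tk)` (the sine sum vanishes under `k ↦ -k`). -/
theorem sum_mul_cexp_mul_I_eq_ofReal (K : ℕ) (p : ℤ → ℝ) (hsymm : ∀ k, p (-k) = p k) (t : ℝ) :
    ∑ k ∈ Finset.Icc (-(K : ℤ)) K, (p k : ℂ) * Complex.exp (((t : ℂ) * I) * (k : ℂ)) =
      ((∑ k ∈ Finset.Icc (-(K : ℤ)) K, p k * Real.cos (t * k) : ℝ) : ℂ) := by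
  apply Complex.ext
  · rw [re_sum_mul_cexp_mul_I, Complex.ofReal_re]
  · rw [im_sum_mul_cexp_mul_I, Complex.ofReal_im]
    refine Finset.sum_involution (fun k _ => -k) ?_ ?_ ?_ ?_
    · intro k _
      rw [hsymm]
      push_cast
      rw [mul_neg, Real.sin_neg]
      ring
    · intro k _ hk h
      apply hk
      have h' : -k = k := h
      have h0 : k = 0 := by omega
      rw [h0]
      simp
    · intro k hk
      simp only [Finset.mem_Icc] at hk ⊢
      omega
    · intro k _
      simp

/-! ### Two real-variable lemmas -/

/-- **Uniform positivity passes to nearby lattice laws**: if `q_N → p` pointwise on a finite `S`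
and `Σ_k p_k cos(sk) ≥ c > 0` for `s ∈ [0, T]`, then for `N` large `Σ_k q_N(k) cos(sk) > 0` on
`[0, T]` (since `|Σ_k (q_N(k) - p_k) cos(sk)| ≤ Σ_k |q_N(k) - p_k| → 0` uniformly in `s`). -/
theorem eventually_forall_cosSum_pos {S : Finset ℤ} {q : ℕ → ℤ → ℝ} {p : ℤ → ℝ}
    (hlim : ∀ k, Tendsto (fun N => q N k) atTop (𝓝 (p k)))
    {T c : ℝ} (hc : 0 < c) (hpos : ∀ s ∈ Set.Icc 0 T, c ≤ ∑ k ∈ S, p k * Real.cos (s * k)) :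
    ∀ᶠ N in atTop, ∀ s ∈ Set.Icc 0 T, 0 < ∑ k ∈ S, q N k * Real.cos (s * k) := by
  have h0 : Tendsto (fun N => ∑ k ∈ S, |q N k - p k|) atTop (𝓝 0) := by
    have h : Tendsto (fun N => ∑ k ∈ S, |q N k - p k|) atTop (𝓝 (∑ k ∈ S, |p k - p k|)) :=
      tendsto_finsetSum _ fun k _ => ((hlim k).sub tendsto_const_nhds).abs
    simpa using h
  filter_upwards [h0.eventually (gt_mem_nhds hc)] with N hN s hs
  have hdiff : |∑ k ∈ S, q N k * Real.cos (s * k) - ∑ k ∈ S, p k * Real.cos (s * k)| ≤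
      ∑ k ∈ S, |q N k - p k| := by
    rw [← Finset.sum_sub_distrib]
    refine (Finset.abs_sum_le_sum_abs _ _).trans (Finset.sum_le_sum fun k _ => ?_)
    rw [← sub_mul, abs_mul]
    exact mul_le_of_le_one_right (abs_nonneg _) (Real.abs_cos_le_one _)
  have h1 := hpos s hs
  rw [abs_le] at hdiff
  linarith [hdiff.1]

/-- **A positive margin beyond `T`**: a continuous `g : ℝ → ℝ` with `g 0 = 1` and no zero on
`(0, T]` (`T > 0`) is bounded below by some `c > 0` on `[0, T + η]` for some `0 < η < T`
(intermediate value theorem, compactness of `[0, T]`, continuity at `T`). -/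
theorem exists_pos_le_of_forall_ne_zero {g : ℝ → ℝ} (hg : Continuous g) (h0 : g 0 = 1)
    {T : ℝ} (hT : 0 < T) (hne : ∀ s, 0 < s → s ≤ T → g s ≠ 0) :
    ∃ c η : ℝ, 0 < c ∧ 0 < η ∧ η < T ∧ ∀ s ∈ Set.Icc 0 (T + η), c ≤ g s := by
  have hne' : ∀ s ∈ Set.Icc 0 T, g s ≠ 0 := by
    intro s hs
    rcases hs.1.eq_or_lt with h | h
    · rw [← h, h0]
      exact one_ne_zero
    · exact hne s h hs.2
  have hposT : ∀ s ∈ Set.Icc 0 T, 0 < g s := by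
    intro s hs
    by_contra hle
    push Not at hle
    have hivt := intermediate_value_Icc' hs.1 (hg.continuousOn (s := Set.Icc 0 s))
    have h0mem : (0 : ℝ) ∈ Set.Icc (g s) (g 0) := ⟨hle, by rw [h0]; exact zero_le_one⟩
    obtain ⟨c, hc, hgc⟩ := hivt h0mem
    exact hne' c ⟨hc.1, hc.2.trans hs.2⟩ hgc
  obtain ⟨s₀, hs₀, hmin⟩ := (isCompact_Icc : IsCompact (Set.Icc (0 : ℝ) T)).exists_isMinOn
    ⟨0, Set.left_mem_Icc.2 hT.le⟩ hg.continuousOn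
  have hc : 0 < g s₀ := hposT s₀ hs₀
  have hgT : g s₀ / 2 < g T := by
    have h := hmin (Set.right_mem_Icc.2 hT.le)
    simp only [Set.mem_setOf_eq] at h
    linarith
  have hT' : ∀ᶠ s in 𝓝 T, g s₀ / 2 < g s := hg.continuousAt.eventually (lt_mem_nhds hgT)
  obtain ⟨ε, hε, hball⟩ := Metric.eventually_nhds_iff.1 hT'
  refine ⟨g s₀ / 2, min (ε / 2) (T / 2), by linarith, by positivity, ?_, ?_⟩
  · have h := min_le_right (ε / 2) (T / 2)
    linarith
  · intro s hs
    rcases le_or_gt s T with h | h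
    · have h1 := hmin (show s ∈ Set.Icc 0 T from ⟨hs.1, h⟩)
      simp only [Set.mem_setOf_eq] at h1
      linarith
    · have hd : dist s T < ε := by
        rw [Real.dist_eq, abs_of_pos (by linarith)]
        have h2 := min_le_left (ε / 2) (T / 2)
        linarith [hs.2]
      exact (hball hd).le

/-! ### Hurwitz + Lee–Yang: real zeros of the finite-volume transforms near a zero of the limit -/

/-- **Zeros of the limit transform are approached by (purely imaginary) zeros of the approximants.**
Let `q_N → p` pointwise on a finite `S ⊂ ℤ`, `Σ_S p = 1`, with the transforms `Σ_k q_N(k) e^{zk}`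
zero-free off the imaginary axis for `N` large (Lee–Yang). If `Σ_k p_k e^{iθ₀k} = 0` then for every
`η > 0` and all large `N` there is a real `t` with `|t - θ₀| < η` and `Σ_k q_N(k) e^{itk} = 0`:
the transforms converge locally uniformly (joint continuity in (coefficients, `z`)), the entire limit
is `1` at `0`, so `iθ₀` is an isolated zero and Hurwitz's one-disc theorem
(`Complex.eventually_exists_zero_mem_ball_of_tendstoUniformlyOn`) yields zeros of the approximants in
a small disc about `iθ₀`, which are purely imaginary by the Lee–Yang hypothesis. -/
theorem eventually_exists_real_zero {S : Finset ℤ} {q : ℕ → ℤ → ℝ} {p : ℤ → ℝ}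
    (hLY : ∀ᶠ N in atTop, ∀ z : ℂ, z.re ≠ 0 →
      ∑ k ∈ S, (q N k : ℂ) * Complex.exp (z * (k : ℂ)) ≠ 0)
    (hlim : ∀ k, Tendsto (fun N => q N k) atTop (𝓝 (p k)))
    (hp1 : ∑ k ∈ S, p k = 1) {θ₀ : ℝ}
    (hzero : ∑ k ∈ S, (p k : ℂ) * Complex.exp (((θ₀ : ℂ) * I) * (k : ℂ)) = 0)
    {η : ℝ} (hη : 0 < η) :
    ∀ᶠ N in atTop, ∃ t : ℝ, |t - θ₀| < η ∧
      ∑ k ∈ S, (q N k : ℂ) * Complex.exp (((t : ℂ) * I) * (k : ℂ)) = 0 := by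
  have hΦ : Continuous (fun cz : (ℤ → ℝ) × ℂ =>
      ∑ k ∈ S, (cz.1 k : ℂ) * Complex.exp (cz.2 * (k : ℂ))) := by
    fun_prop
  set Φ : C((ℤ → ℝ) × ℂ, ℂ) := ⟨_, hΦ⟩
  set F : ℕ → ℂ → ℂ := fun N w => Φ.curry (q N) w with hF
  set f : ℂ → ℂ := fun w => Φ.curry p w with hf
  have hloc : TendstoLocallyUniformly F f atTop :=
    ContinuousMap.tendsto_iff_tendstoLocallyUniformly.1
      ((Φ.curry.continuous.tendsto p).comp (tendsto_pi_nhds.2 hlim))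
  have hFdiff : ∀ N, Differentiable ℂ (F N) := fun N => by
    show Differentiable ℂ (fun w => ∑ k ∈ S, (q N k : ℂ) * Complex.exp (w * (k : ℂ)))
    fun_prop
  have hfdiff : Differentiable ℂ f := by
    show Differentiable ℂ (fun w => ∑ k ∈ S, (p k : ℂ) * Complex.exp (w * (k : ℂ)))
    fun_prop
  have hf0 : f 0 = 1 := by
    show ∑ k ∈ S, (p k : ℂ) * Complex.exp (0 * (k : ℂ)) = 1
    simp only [zero_mul, Complex.exp_zero, mul_one]
    exact_mod_cast hp1
  set z₀ : ℂ := (θ₀ : ℂ) * I with hz₀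
  have hfz₀ : f z₀ = 0 := hzero
  -- `z₀` is an isolated zero of the entire, not identically vanishing `f`
  have han : AnalyticOnNhd ℂ f Set.univ := hfdiff.differentiableOn.analyticOnNhd isOpen_univ
  have hiso : ∀ᶠ z in 𝓝[≠] z₀, f z ≠ 0 := by
    rcases (han z₀ (Set.mem_univ _)).eventually_eq_zero_or_eventually_ne_zero with h | h
    · exfalso
      have h1 := han.eqOn_zero_of_preconnected_of_eventuallyEq_zero isPreconnected_univ
        (Set.mem_univ _) h
      have h2 : f 0 = 0 := h1 (Set.mem_univ 0)
      rw [hf0] at h2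
      exact one_ne_zero h2
    · exact h
  obtain ⟨r₀, hr₀, hball⟩ := Metric.eventually_nhds_iff_ball.1 (eventually_nhdsWithin_iff.1 hiso)
  set r : ℝ := min (r₀ / 2) (η / 2) with hr
  have hrpos : 0 < r := by positivity
  have hrr₀ : r < r₀ := by
    have h := min_le_left (r₀ / 2) (η / 2)
    linarith
  have hrη : r < η := by
    have h := min_le_right (r₀ / 2) (η / 2)
    linarith
  have hsphere : ∀ z ∈ Metric.sphere z₀ r, f z ≠ 0 := by
    intro z hz
    rw [Metric.mem_sphere] at hz
    refine hball z (Metric.mem_ball.2 (by rw [hz]; exact hrr₀)) ?_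
    rintro rfl
    rw [dist_self] at hz
    exact hrpos.ne hz
  have hunif : TendstoUniformlyOn F f atTop (Metric.closedBall z₀ r) :=
    (tendstoLocallyUniformly_iff_forall_isCompact.1 hloc) _ (isCompact_closedBall _ _)
  have hev := Complex.eventually_exists_zero_mem_ball_of_tendstoUniformlyOn hrpos
    (Eventually.of_forall fun N => (hFdiff N).diffContOnCl) hunif
    hfdiff.continuous.continuousOn hfz₀ hsphere
  filter_upwards [hev, hLY] with N hN hNLY
  obtain ⟨z, hz, hFz⟩ := hN
  have hre : z.re = 0 := by
    by_contra hne
    exact hNLY z hne hFz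
  refine ⟨z.im, ?_, ?_⟩
  · have h1 : |z.im - θ₀| ≤ ‖z - z₀‖ := by
      have h2 : (z - z₀).im = z.im - θ₀ := by simp [hz₀]
      rw [← h2]
      exact Complex.abs_im_le_norm _
    have h3 : ‖z - z₀‖ < r := by
      rw [← dist_eq_norm]
      exact Metric.mem_ball.1 hz
    linarith
  · have hz' : ((z.im : ℂ) * I) = z := by
      apply Complex.ext <;> simp [hre]
    rw [hz']
    exact hFz

end LeeYangGapMonotonicityTransfer

open LeeYangGapMonotonicityTransfer

/-- **`MonotonicityTransfer` (item stmt-CriticalPhenomena-4948 of route `LeeYangGap`), proved**: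
the finite-volume antitonicity of the first real zero of `θ ↦ ⟨cos(θ M_L)⟩^free_{box 3 M;β,0}` in `β`
(Camia–Jiang–Newman 2023 Thm 2, the route item `FirstZeroAntitoneInBeta`, hypothesis `H`) implies its
infinite-volume form in the state `plusExpect 3 · 0` for `0 ≤ β ≤ β' ≤ β_c(3)`: every zero `θ > 0`
of `⟨cos(θ M_L)⟩_β` bounds from above a zero `θ' ∈ (0, θ]` of `⟨cos(θ' M_L)⟩_{β'}`. Proof (file
header): lattice laws of `M_L` under the free boxes converge to the plus-state law (`m*(β) = 0` for
`β ≤ β_c(3)`), Lee–Yang zero-freeness of their Laplace transforms off the imaginary axis, Hurwitz's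
one-disc theorem at the zero `iθ` of the limit transform, and a contrapositive positivity argument at
`β'`. Settles item stmt-CriticalPhenomena-4948 (exact signature). [folklore] -/
theorem monotonicityTransfer_proof : LeeYangGap.MonotonicityTransfer := by
  unfold LeeYangGap.MonotonicityTransfer
  intro H L β β' θ₀ hβ hββ' hβ'c hθ₀ hzero
  set B : Finset (Site 3) := box 3 L with hB
  set S : Finset ℤ := Finset.Icc (-(#B : ℤ)) (#B) with hS
  have hβ' : 0 ≤ β' := hβ.trans hββ'
  have hβc : β ≤ criticalBeta 3 := hββ'.trans hβ'c
  -- `m*` vanishes on `[0, β_c(3)]`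
  have hm_of : ∀ b : ℝ, 0 ≤ b → b ≤ criticalBeta 3 → spontaneousMagnetization 3 b = 0 := by
    intro b hb hbc
    rcases hbc.lt_or_eq with hlt | heq
    · exact spontaneousMagnetization_eq_zero_of_lt_criticalBeta_holds (d := 3) (β := b) hb hlt
    · rw [heq]
      exact spontaneousMagnetization_criticalBeta_eq_zero_holds (d := 3) le_rfl
  have hm : spontaneousMagnetization 3 β = 0 := hm_of β hβ hβc
  have hm' : spontaneousMagnetization 3 β' = 0 := hm_of β' hβ' hβ'c
  -- plus Gibbs measures (linearity of the plus state on block functions)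
  obtain ⟨μ, hμG, -, hμ⟩ := exists_plusMeasure_holds (d := 3) (β := β) (h := (0 : ℝ)) hβ
  haveI : IsProbabilityMeasure μ :=
    ((mem_isingGibbsMeasures_iff 3 _ 0 μ).1 hμG).isProbabilityMeasure
  obtain ⟨μ', hμG', -, hμ'⟩ := exists_plusMeasure_holds (d := 3) (β := β') (h := (0 : ℝ)) hβ'
  haveI : IsProbabilityMeasure μ' :=
    ((mem_isingGibbsMeasures_iff 3 _ 0 μ').1 hμG').isProbabilityMeasure
  -- the lattice laws of the block spin
  set p : ℤ → ℝ := fun k => plusExpect 3 β 0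
    (fun σ => if (∑ x ∈ B, spinAt x σ) = (k : ℝ) then (1 : ℝ) else 0) with hp
  set p' : ℤ → ℝ := fun k => plusExpect 3 β' 0
    (fun σ => if (∑ x ∈ B, spinAt x σ) = (k : ℝ) then (1 : ℝ) else 0) with hp'
  set q : ℕ → ℤ → ℝ := fun N k => isingExpect (zdGraph 3) (box 3 N) β 0 .free
    (fun σ => if (∑ x ∈ B, spinAt x σ) = (k : ℝ) then (1 : ℝ) else 0) with hq
  set q' : ℕ → ℤ → ℝ := fun N k => isingExpect (zdGraph 3) (box 3 N) β' 0 .free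
    (fun σ => if (∑ x ∈ B, spinAt x σ) = (k : ℝ) then (1 : ℝ) else 0) with hq'
  have hlim : ∀ k, Tendsto (fun N => q N k) atTop (𝓝 (p k)) := fun k =>
    tendsto_isingExpect_free_spinFun hβ hm B
      (fun s => if (∑ x ∈ B, s x) = (k : ℝ) then (1 : ℝ) else 0)
      (fun _ _ hst => by rw [Finset.sum_congr rfl hst])
  have hlim' : ∀ k, Tendsto (fun N => q' N k) atTop (𝓝 (p' k)) := fun k =>
    tendsto_isingExpect_free_spinFun hβ' hm' B
      (fun s => if (∑ x ∈ B, s x) = (k : ℝ) then (1 : ℝ) else 0)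
      (fun _ _ hst => by rw [Finset.sum_congr rfl hst])
  have hp1 : ∑ k ∈ S, p k = 1 := sum_plusExpect_blockInd hβ hμ B
  have hp'1 : ∑ k ∈ S, p' k = 1 := sum_plusExpect_blockInd hβ' hμ' B
  have hpsymm : ∀ k, p (-k) = p k := fun k => plusExpect_blockInd_neg hβ hm B k
  -- `⟨cos(s M_L)⟩` as cosine sums against the laws
  have hcos_plus : ∀ s : ℝ, plusExpect 3 β 0 (fun σ => Real.cos (s * ∑ x ∈ B, spinAt x σ)) =
      ∑ k ∈ S, p k * Real.cos (s * k) := fun s =>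
    plusExpect_blockFun_eq_sum hβ hμ B (fun m => Real.cos (s * m))
  have hcos_plus' : ∀ s : ℝ, plusExpect 3 β' 0 (fun σ => Real.cos (s * ∑ x ∈ B, spinAt x σ)) =
      ∑ k ∈ S, p' k * Real.cos (s * k) := fun s =>
    plusExpect_blockFun_eq_sum hβ' hμ' B (fun m => Real.cos (s * m))
  have hcos_fin : ∀ (b : ℝ) (N : ℕ) (s : ℝ),
      isingExpect (zdGraph 3) (box 3 N) b 0 .free (fun σ => Real.cos (s * ∑ x ∈ B, spinAt x σ)) =
        ∑ k ∈ S, isingExpect (zdGraph 3) (box 3 N) b 0 .free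
          (fun σ => if (∑ x ∈ B, spinAt x σ) = (k : ℝ) then (1 : ℝ) else 0) * Real.cos (s * k) :=
    fun b N s => isingExpect_blockFun_eq_sum (box 3 N) B b .free (fun m => Real.cos (s * m))
  -- contrapositive
  by_contra hno
  push Not at hno
  -- a positive margin for `s ↦ ⟨cos(s M_L)⟩_{β'}` on `[0, θ₀ + η]`
  obtain ⟨c, η, hc, hη, hηθ, hcle⟩ := exists_pos_le_of_forall_ne_zero
    (g := fun s => ∑ k ∈ S, p' k * Real.cos (s * k)) (by fun_prop)
    (by simp [hp'1]) hθ₀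
    (fun s hs hsθ => by rw [← hcos_plus' s]; exact hno s hs hsθ)
  -- finite-volume positivity at `β'` for large `N`
  have hE1 : ∀ᶠ N in atTop, ∀ s ∈ Set.Icc 0 (θ₀ + η), 0 < ∑ k ∈ S, q' N k * Real.cos (s * k) :=
    eventually_forall_cosSum_pos hlim' hc hcle
  -- Lee–Yang for the finite-volume laws at `β`
  obtain ⟨N₀, hN₀⟩ := exists_forall_subset_box 3 B
  have hLY : ∀ᶠ N in atTop, ∀ z : ℂ, z.re ≠ 0 →
      ∑ k ∈ S, (q N k : ℂ) * Complex.exp (z * (k : ℂ)) ≠ 0 := by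
    filter_upwards [eventually_ge_atTop N₀] with N hN
    exact fun z hz => sum_isingExpect_blockInd_mul_cexp_ne_zero hβ (hN₀ N hN) hz
  -- the limit transform vanishes at `iθ₀`
  have hzeroC : ∑ k ∈ S, (p k : ℂ) * Complex.exp (((θ₀ : ℂ) * I) * (k : ℂ)) = 0 := by
    have h1 := sum_mul_cexp_mul_I_eq_ofReal (#B) p hpsymm θ₀
    have h2 : ∑ k ∈ S, p k * Real.cos (θ₀ * k) = 0 := (hcos_plus θ₀).symm.trans hzero
    refine h1.trans ?_
    rw [show (∑ k ∈ Finset.Icc (-(#B : ℤ)) (#B), p k * Real.cos (θ₀ * k)) = 0 from h2]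
    simp
  -- Hurwitz: real zeros of the finite-volume transforms at `β` near `θ₀`
  have hE2 := eventually_exists_real_zero hLY hlim hp1 hzeroC hη
  obtain ⟨N, hN1, hN2, hNL⟩ := (hE1.and (hE2.and (eventually_ge_atTop L))).exists
  obtain ⟨t, ht, htz⟩ := hN2
  have ht' := abs_lt.1 ht
  have htpos : 0 < t := by linarith
  have htle : t ≤ θ₀ + η := by linarith
  have hfz : isingExpect (zdGraph 3) (box 3 N) β 0 .free
      (fun σ => Real.cos (t * ∑ x ∈ B, spinAt x σ)) = 0 := by
    have h := congrArg Complex.re htz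
    rw [re_sum_mul_cexp_mul_I, Complex.zero_re] at h
    rw [hcos_fin]
    exact h
  -- move the zero to `β'` in finite volume and contradict positivity
  obtain ⟨θ', hθ'pos, hθ'le, hθ'zero⟩ := H N L β β' t hNL hβ hββ' htpos hfz
  have hposθ' := hN1 θ' ⟨hθ'pos.le, hθ'le.trans htle⟩
  rw [hcos_fin] at hθ'zero
  exact hposθ'.ne' hθ'zero

end Summit.CriticalPhenomena.Ising3DConformalLimit.Theorems

end
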